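import Mathlib
import Literature.AlgebraicGeometry.Resolution.BlowupsLocal
import Literature.AlgebraicGeometry.Resolution.NormalCrossingsLocal
import Literature.AlgebraicGeometry.Resolution.QuasiProjectiveResolution
import Summits.ResolutionOfSingularities.ResolutionOfSingularities.Theorems.WildQuotientsWildQuotientResolutionBlowupLocalExit

/-!
# The «two blow-ups» exit: a piece of the cover that needs a SECOND blow-up over its own vertex

(crux stmt-ResolutionOfSingularities-15640 `WildQuotients.WildQuotientResolution`, line `Sketch`;
chain w45c, RUNG V5 = the `J₅` toric exit (`L/w45c/CHAIN.md` v8 §5, res-L1-w45c-plan-1 NAMING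
2026-08-27T10:09:28Z; design `L/res-L1-w45c-idea-2/RT-LADDER.md` §3: the `μ₄`-vertex piece
`¼(1,p̄,2,3) × 𝔸` of `Bl_w𝔸⁵/J₅` is resolved by TWO iterated blow-ups of reduced centres, the second
centre lying over the vertex line). [OURS · L1 W4.5c] — generic glue; NOT a statement of the
manuscript; replaces the role of no printed item. Lead prover res-L1-w45c-lead-1.)

`BlowupExit.hasResolution_of_isBlowup_locally_regular₂`: `Y` integral, locally Noetherian,
`𝓘 ≠ ⊥` an ideal sheaf, `⨆ U i = ⊤` an open cover and a distinguished index `i₀` such that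

* for `i ≠ i₀` SOME blow-up of `U i` along `𝓘|_{U i}` is regular (as in the one-blow-up exit
  `hasResolution_of_isBlowup_locally_regular`, p488078/stub-3);
* SOME blow-up `p : B → U i₀` of `U i₀` along `𝓘|_{U i₀}` carries a closed `C ⊆ B` whose points
  lie over NO other `U j` (`j ≠ i₀`) — so that its transport to the global first blow-up `Y₁` is
  closed in `Y₁` — and SOME blow-up of `B` along the REDUCED ideal sheaf of `C` is regular;
* a non-empty open `W` off the centre (`𝓘|_W = ⊤`) inside `⋃_{j ≠ i₀} U j` (so that the second
  centre is not everything);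

then `Y` has a resolution of singularities: `Y₂ = Bl_{C} Bl_𝓘 Y → Y`, the composite of two
blow-ups (`exists_isBlowup` twice; `IsBlowup.unique`/`restrict`/`comp_iso` to move the local data
to `Y₁ = Bl_𝓘 Y`; `Scheme.HasResolution.of_isBirational` for the first floor).
-/

-- single-problem summit: the doubled namespace component `ResolutionOfSingularities` is forced
set_option linter.dupNamespace false

noncomputable section

universe u

open CategoryTheory AlgebraicGeometry TopologicalSpace
open Literature.AlgebraicGeometry.Resolution

namespace Summit.ResolutionOfSingularities.ResolutionOfSingularities.Theorems.WildQuotientResolution.BlowupExit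

/-- Points of a blow-up restricted over `U` map to `U`: `π (ι (e b)) = U.ι (p b)` when
`e : B ≅ π⁻¹ U` is the comparison isomorphism with `e.hom ≫ π|_U = p`. [folklore] -/
theorem π_apply_of_iso_restrict {Y₁ Y B : Scheme.{u}} (π : Y₁ ⟶ Y) (U : Y.Opens)
    (p : B ⟶ (U : Scheme.{u})) (e : B ≅ (π ⁻¹ᵁ U : Scheme.{u})) (he : e.hom ≫ (π ∣_ U) = p)
    (b : B) : π.base ((π ⁻¹ᵁ U).ι.base (e.hom.base b)) = U.ι.base (p.base b) := by
  have h : (e.hom ≫ (π ⁻¹ᵁ U).ι ≫ π) = p ≫ U.ι := by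
    rw [← morphismRestrict_ι, ← Category.assoc, he]
  have := congrArg (fun φ : B ⟶ Y => φ.base b) h
  simpa [Scheme.Hom.comp_base] using this

/-- **The two-blow-ups exit.** `Y` integral locally Noetherian, `𝓘 ≠ ⊥`, `⨆ U i = ⊤`; for
`i ≠ i₀` some blow-up of `U i` along `𝓘|_{U i}` is regular; some blow-up `p : B → U i₀` along
`𝓘|_{U i₀}` carries a closed `C ⊆ B` lying over no `U j`, `j ≠ i₀`, with some blow-up of `B` along
the reduced ideal sheaf of `C` regular; and a non-empty open `W ⊆ ⋃_{j ≠ i₀} U j` has `𝓘|_W = ⊤`.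
Then `Y` has a resolution of singularities. [OURS · L1 W4.5c]
[cite: GortzWedhorn2020, Prop. 13.91–13.92] -/
theorem hasResolution_of_isBlowup_locally_regular₂ {Y : Scheme.{u}} [IsIntegral Y]
    [IsLocallyNoetherian Y] (𝓘 : Y.IdealSheafData) (h𝓘 : 𝓘 ≠ ⊥) {ι : Type*} (U : ι → Y.Opens)
    (hU : ⨆ i, U i = ⊤) (i₀ : ι)
    (h : ∀ i, i ≠ i₀ → ∃ (B : Scheme.{u}) (p : B ⟶ (U i : Scheme.{u})),
      IsBlowup p (𝓘.comap (U i).ι) ∧ Scheme.IsRegular B)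
    (W : Y.Opens) (hWne : (W : Set Y).Nonempty) (h𝓘W : 𝓘.comap W.ι = ⊤)
    (hW : ∀ y ∈ W, ∃ j, j ≠ i₀ ∧ y ∈ U j)
    (h₀ : ∃ (B : Scheme.{u}) (p : B ⟶ (U i₀ : Scheme.{u})), IsBlowup p (𝓘.comap (U i₀).ι) ∧
      ∃ C : Closeds B, (∀ b ∈ C, ∀ j, j ≠ i₀ → (U i₀).ι.base (p.base b) ∉ U j) ∧
        ∃ (B' : Scheme.{u}) (p' : B' ⟶ B),
          IsBlowup p' (Scheme.IdealSheafData.vanishingIdeal C) ∧ Scheme.IsRegular B') :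
    Scheme.HasResolution Y := by
  classical
  -- the first floor `π : Y₁ = Bl_𝓘 Y → Y`
  obtain ⟨Y₁, π, hπ⟩ := exists_isBlowup Y 𝓘
  haveI : IsProper π := hπ.isProper
  haveI : IsIntegral Y₁ := hπ.isIntegral h𝓘
  haveI : IsLocallyNoetherian Y₁ := LocallyOfFiniteType.isLocallyNoetherian π
  obtain ⟨B, p, hp, C, hC, B', p', hp', hB'⟩ := h₀
  -- `e : B ≅ π⁻¹(U i₀)` over `U i₀`
  obtain ⟨e, he, he'⟩ := hp.unique (hπ.restrict (U i₀))
  let V : ι → Y₁.Opens := fun j => π ⁻¹ᵁ U j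
  have hV : ⨆ j, V j = ⊤ := by
    change ⨆ j, π ⁻¹ᵁ U j = ⊤
    rw [← Scheme.Hom.preimage_iSup, hU, Scheme.Hom.preimage_top]
  -- the open immersion `f : B ≅ π⁻¹(U i₀) ↪ Y₁` and the second centre `Z' = f(C)`
  let f : B ⟶ Y₁ := e.hom ≫ (V i₀).ι
  haveI : IsOpenImmersion f := inferInstance
  have hf_apply : ∀ b : B, f.base b = (V i₀).ι.base (e.hom.base b) := fun b => by
    simp [f, Scheme.Hom.comp_base]
  have hπf : ∀ b : B, π.base (f.base b) = (U i₀).ι.base (p.base b) := fun b => by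
    rw [hf_apply]; exact π_apply_of_iso_restrict π (U i₀) p e he b
  have hf_inj : Function.Injective f.base := f.isOpenEmbedding.injective
  -- every point of `π⁻¹(U i₀)` is in the range of `f`
  have hf_range : ∀ y : Y₁, y ∈ V i₀ → ∃ b : B, f.base b = y := by
    intro y hy
    refine ⟨e.inv.base ⟨y, hy⟩, ?_⟩
    rw [hf_apply]
    have h1 : e.hom.base (e.inv.base ⟨y, hy⟩) = ⟨y, hy⟩ := by
      change (e.inv ≫ e.hom).base ⟨y, hy⟩ = ⟨y, hy⟩
      rw [e.inv_hom_id]; rfl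
    rw [h1]; rfl
  let Z' : Set Y₁ := f.base '' (C : Set B)
  -- points of `Z'` lie over no `U j`, `j ≠ i₀`
  have hZ'U : ∀ y ∈ Z', ∀ j, j ≠ i₀ → y ∉ V j := by
    rintro _ ⟨b, hb, rfl⟩ j hj hyj
    exact hC b hb j hj (by simpa [V, hπf b] using hyj)
  -- `Z'` is closed: its complement is `f(Cᶜ) ∪ ⋃_{j ≠ i₀} π⁻¹(U j)`
  have hZ'c : IsClosed Z' := by
    have hc : Z'ᶜ = f.base '' (C : Set B)ᶜ ∪ ⋃ j ∈ {j | j ≠ i₀}, (V j : Set Y₁) := by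
      ext y
      constructor
      · intro hy
        have hy' : y ∈ (⨆ j, V j : Y₁.Opens) := by rw [hV]; exact Opens.mem_top y
        obtain ⟨j, hj⟩ := Opens.mem_iSup.mp hy'
        by_cases hji : j = i₀
        · subst hji
          obtain ⟨b, rfl⟩ := hf_range y hj
          exact Or.inl ⟨b, fun hb => hy ⟨b, hb, rfl⟩, rfl⟩
        · exact Or.inr (Set.mem_biUnion (show j ∈ {j | j ≠ i₀} from hji) hj)
      · rintro (⟨b, hb, rfl⟩ | hy) hyZ
        · obtain ⟨b', hb', hbb'⟩ := hyZ
          exact hb (hf_inj hbb' ▸ hb')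
        · obtain ⟨j, hj, hyj⟩ := Set.mem_iUnion₂.mp hy
          exact hZ'U y hyZ j hj hyj
    rw [← isOpen_compl_iff, hc]
    exact (f.isOpenEmbedding.isOpenMap _ C.isClosed.isOpen_compl).union
      (isOpen_biUnion fun j _ => (V j).isOpen)
  let Zc : Closeds Y₁ := ⟨Z', hZ'c⟩
  -- a point of `Y₁` outside `Z'`: over `W`, where `π` is an isomorphism
  have hne : ∃ y : Y₁, y ∉ Z' := by
    obtain ⟨w, hw⟩ := hWne
    haveI : IsIso (π ∣_ W) := (hπ.restrict W).isIso (h𝓘W ▸ isEffectiveCartier_top)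
    let y₀ : (π ⁻¹ᵁ W : Scheme.{u}) := (inv (π ∣_ W)).base ⟨w, hw⟩
    refine ⟨(π ⁻¹ᵁ W).ι.base y₀, fun hy => ?_⟩
    have hπy : π.base ((π ⁻¹ᵁ W).ι.base y₀) = w := by
      have h1 : ((π ⁻¹ᵁ W).ι ≫ π).base y₀ = (π ∣_ W ≫ W.ι).base y₀ := by rw [morphismRestrict_ι]
      simp only [Scheme.Hom.comp_base, TopCat.coe_comp, Function.comp_apply] at h1
      rw [h1]
      have h2 : (π ∣_ W).base y₀ = ⟨w, hw⟩ := by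
        change (inv (π ∣_ W) ≫ π ∣_ W).base ⟨w, hw⟩ = ⟨w, hw⟩
        rw [IsIso.inv_hom_id]; rfl
      rw [h2]; rfl
    obtain ⟨j, hj, hwj⟩ := hW w hw
    exact hZ'U _ hy j hj (by change π.base _ ∈ U j; rw [hπy]; exact hwj)
  -- the second centre `𝓘' = 𝓘(Z')` is a non-zero ideal sheaf
  let 𝓘' : Y₁.IdealSheafData := Scheme.IdealSheafData.vanishingIdeal Zc
  have h𝓘' : 𝓘' ≠ ⊥ := by
    intro hbot
    have hsupp : (𝓘'.support : Set Y₁) = Z' := Scheme.IdealSheafData.coe_support_vanishingIdeal Zc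
    rw [Scheme.IdealSheafData.support_eq_top_iff.mpr hbot] at hsupp
    obtain ⟨y, hy⟩ := hne
    exact hy (hsupp ▸ trivial)
  -- the local data on `Y₁`
  have hloc : ∀ j, ∃ (B'' : Scheme.{u}) (p'' : B'' ⟶ (V j : Scheme.{u})),
      IsBlowup p'' (𝓘'.comap (V j).ι) ∧ Scheme.IsRegular B'' := by
    intro j
    by_cases hji : j = i₀
    · subst hji
      refine ⟨B', p' ≫ e.hom, ?_, hB'⟩
      have hcomp := hp'.comp_iso e
      have heq : (Scheme.IdealSheafData.vanishingIdeal C).comap e.inv = 𝓘'.comap (V j).ι := by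
        rw [comap_vanishingIdeal_of_isOpenImmersion, comap_vanishingIdeal_of_isOpenImmersion]
        congr 1
        ext x
        simp only [Closeds.coe_preimage, Set.mem_preimage]
        constructor
        · intro hx
          refine ⟨e.inv.base x, hx, ?_⟩
          rw [hf_apply]
          have h1 : e.hom.base (e.inv.base x) = x := by
            change (e.inv ≫ e.hom).base x = x
            rw [e.inv_hom_id]; rfl
          rw [h1]
        · rintro ⟨b, hb, hbx⟩
          rw [hf_apply] at hbx
          have h2 : e.hom.base b = x := (V j).ι.isOpenEmbedding.injective hbx
          have h3 : e.inv.base x = b := by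
            rw [← h2]
            change (e.hom ≫ e.inv).base b = b
            rw [e.hom_inv_id]; rfl
          change e.inv.base x ∈ (C : Set B)
          rw [h3]; exact hb
      rwa [heq] at hcomp
    · have hreg : Scheme.IsRegular (V j : Scheme.{u}) :=
        isRegular_preimage_of_isBlowup_regular hπ (U j) (h j hji)
      refine exists_isBlowup_regular_of_comap_eq_top 𝓘' (V j) hreg ?_
      rw [comap_vanishingIdeal_of_isOpenImmersion]
      have hempty : (Zc.preimage (V j).ι.continuous : Closeds (V j : Scheme.{u})) = ⊥ := by
        ext x
        simp only [Closeds.coe_preimage, Set.mem_preimage, Closeds.coe_bot, Set.mem_empty_iff_false,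
          iff_false]
        intro hx
        exact hZ'U _ hx j hji (by simp)
      rw [hempty, Scheme.IdealSheafData.vanishingIdeal_bot]
  have hres₁ : Scheme.HasResolution Y₁ :=
    hasResolution_of_isBlowup_locally_regular 𝓘' h𝓘' V hV hloc
  exact Scheme.HasResolution.of_isBirational π (hπ.isBirational' h𝓘) hres₁

end Summit.ResolutionOfSingularities.ResolutionOfSingularities.Theorems.WildQuotientResolution.BlowupExit

end
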